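import Literature.Computability.QuantumComplexity.RazTalMachineUniform
import Literature.Computability.QuantumComplexity.QueryComplexityProofs
import Literature.Computability.QuantumComplexity.BQPCollapsingOracle
import Literature.Computability.QuantumComplexity.OracleSeparationBQPBPP
import HarnessLib

/-!
# Discharge of `exists_oracle_BQPRel_not_subset_PHRel` (quantum-advantage.S14), of `exists_oracle_BQPRel_subset_BPPRel`
# and of `exists_oracle_BQPRel_not_subset_BPPRel` (quantum-advantage.S13)

Topic `Literature/Computability/QuantumComplexity`; proof of the named fact
`Literature.Computability.QuantumComplexity.exists_oracle_BQPRel_not_subset_PHRel` of file `OracleSeparations`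
(Raz–Tal, *Oracle separation of BQP and PH*, J. ACM 69 (2022), Cor. 1.5: "There exists an oracle
`O` relative to which `BQP^O ⊄ PH^O`"), in H21's model (`BQPRel`: polynomial-time uniform
Clifford+T circuit families with XOR oracle gates; `PHRel`: the relativized polynomial hierarchy
of the complexity core).

The chain, all proved in the tree:

* `OracleSeparationBQPPH.lean` — Raz–Tal §8 and App. A: the unary language `L(O)`, the random
  oracle, Claim 8.1 (`razTal2022_claim81_holds`), and the diagonalization reducing Cor. 1.5 to
  the named facts `RazTal2022_bqpMachine`, `RazTal2022_thm74`, `FSS84_phWindowCircuits`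
  (the conversion `PH^O → AC⁰`, Furst–Saxe–Sipser) and `countable_polyTimeOracleAlg`;
* `OracleSeparationBQPPHProofs.lean` — `fSS84_phWindowCircuits_holds`,
  `countable_polyTimeOracleAlg_holds`, and the reduction with the two remaining hypotheses,
  `exists_oracle_BQPRel_not_subset_PHRel_of_bqpMachine_of_tal`;
* `RazTalForrelation.lean`, `RazTalBoundedDepth.lean`, `QueryComplexityProofs.lean` — Raz–Tal
  §4–7 from Tal's `AC⁰` Fourier-tail bound, itself proved (`Tal2017_fourierL1_ac0_holds`, from
  Håstad's multi-switching lemma, `SwitchingLemma.lean`, `FourierTails.lean`,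
  `ACFourierTails.lean`);
* `ControlledHadamard.lean`, `CircuitEmbedding.lean`, `RazTalBlocks.lean`, `RazTalMachine.lean`,
  `RazTalMachineUniform.lean` — the uniform `BQP^O` machine running `Q₁`
  (`razTal2022_bqpMachine_holds`).

**The collapsing oracle** (appended). The named fact
`Literature.Computability.QuantumComplexity.exists_oracle_BQPRel_subset_BPPRel` of
`OracleSeparations.lean` — there is an oracle `A` with `BQP^A ⊆ BPP^A` (folklore; printed e.g.
in Fortnow–Rogers 1999, Thm. 4.2, `P^C = BPP^C = BQP^C`, via a `PSPACE`-complete oracle and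
Bernstein–Vazirani's relativizing `BQP ⊆ PSPACE`, Thm. 8.4) — is discharged from
`BQPCollapsingOracle.lean`, which proves `BQP^A ⊆ P^A ⊆ BPP^A` for Ko's self-encoding oracle
`A = K(A)` (`BQPCollapse.oracleA`: the codes `⟨x, sigmaEncode ⟨|x|, m, C⟩⟩` of oracle circuits
accepting `x` with probability `≥ 1/2` relative to the part of `A` below the code's length; an
`N`-wire circuit queries only strings of length `< N`), the Karp reduction being the uniformity
machine of the family paired with the input.

**`BQP^A ⊄ BPP^A` (quantum-advantage.S13)** (appended). The named fact
`Literature.Computability.QuantumComplexity.exists_oracle_BQPRel_not_subset_BPPRel` of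
`OracleSeparations.lean` — there is an oracle `A` with `BQP^A ⊄ BPP^A` (Bernstein–Vazirani 1997,
§8.4: Thm. 8.10, the recursive Fourier sampling language `R_O` is accepted in polynomial time
with probability `1` by an oracle QTM for every legal oracle `O`, with Cor. 8.14, relative to a
random legal oracle `R_O ∉ BPTime(n^{o(log n)})^O` with probability `1`; abstract: "a problem,
relative to an oracle, that can be solved in polynomial time on a quantum Turing machine, but
requires superpolynomial time on a bounded-error probabilistic Turing machine, and thus not in
the class BPP") — is discharged from the Raz–Tal chain above: `OracleSeparationBQPBPP.lean`
re-runs the Appendix-A diagonalization against bounded-error probabilistic oracle machines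
(`exists_oracle_BQPRel_not_subset_BPPRel_of`, using only the depth-2 base case of the window
circuits), and the five named facts it consumes are the discharged ones listed above
(`razTal2022_bqpMachine_holds`, `razTal2022_claim81_holds`, `fSS84_phWindowCircuits_holds`,
`countable_polyTimeOracleAlg_holds`, `razTal2022_thm74_of_tal Tal2017_fourierL1_ac0_holds`).

## References

* L. Fortnow, J. Rogers, *Complexity limitations on quantum computation*, JCSS 59 (1999)
  240–252 = arXiv:cs/9811023, Thm. 4.2 and its proof (arXiv p. 7) [FortnowRogers1999JCSS].
* E. Bernstein, U. Vazirani, *Quantum complexity theory*, SIAM J. Comput. 26 (1997) 1411–1473,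
  Thm. 8.4 (`BQP ⊆ PSPACE`), §8.3 (oracle QTMs); §8.4, Thm. 8.10 and Cor. 8.14 (the oracle
  separation from `BPP`) [BernsteinVazirani1997SICOMP]
  (= [BernsteinVazirani1997], the key of the facts' own cites).
* K.-I Ko, *Constructing oracles by lower bound techniques for circuits*, in: Combinatorics,
  Computing and Complexity (Kluwer, 1989) 30–76, §5 (p. 21) and p. 24 [Ko1989].
* R. Raz, A. Tal, *Oracle separation of BQP and PH*, J. ACM 69 (2022), Art. 30, Cor. 1.5
  [RazTalJACM2022] (= [RazTal2022], the key of the fact's own cite).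
* A. Tal, *Tight bounds on the Fourier spectrum of AC⁰*, CCC 2017, Cor. 4.8 [Tal2017].
-/

namespace Literature.Computability.QuantumComplexity

/-- **quantum-advantage.S14 (Raz–Tal, Corollary 1.5), discharged**: there is an oracle
`A ⊆ {0,1}*` with `BQP^A ⊄ PH^A` — the named fact `exists_oracle_BQPRel_not_subset_PHRel` holds
unconditionally. [cite: RazTalJACM2022, Cor. 1.5] -/
theorem exists_oracle_BQPRel_not_subset_PHRel_holds : exists_oracle_BQPRel_not_subset_PHRel :=
  exists_oracle_BQPRel_not_subset_PHRel_of_bqpMachine_of_tal razTal2022_bqpMachine_holds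
    Tal2017_fourierL1_ac0_holds

/-- **Collapsing half of the relativization barrier for `BQP` versus `BPP`, discharged**: there
is an oracle `A ⊆ {0,1}*` with `BQP^A ⊆ BPP^A` — the named fact
`exists_oracle_BQPRel_subset_BPPRel` holds unconditionally. The witness is the self-encoding
oracle `BQPCollapse.oracleA` of `BQPCollapsingOracle.lean` (`BQP^A ⊆ P^A ⊆ BPP^A`); the printed
proofs use a `PSPACE`-complete oracle instead (same statement).
[cite: FortnowRogers1999JCSS, Thm. 4.2 (arXiv numbering, p. 7)] [cite: BernsteinVazirani1997SICOMP, Thm. 8.4 with §8.3] -/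
theorem exists_oracle_BQPRel_subset_BPPRel_holds : exists_oracle_BQPRel_subset_BPPRel :=
  exists_oracle_BQPRel_subset_BPPRel'

/-- **quantum-advantage.S13 (Bernstein–Vazirani 1997, §8.4: Thm. 8.10 with Cor. 8.14), discharged**:
there is an oracle `A ⊆ {0,1}*` with `BQP^A ⊄ BPP^A` — the named fact
`exists_oracle_BQPRel_not_subset_BPPRel` holds unconditionally. Bernstein–Vazirani prove it with
the recursive Fourier sampling problem relative to a random legal oracle (Thm. 8.10: in `EQP^O`;
Cor. 8.14: not in `BPTime(n^{o(log n)})^O` with probability `1`); the proof here is Raz–Tal's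
Forrelation oracle construction (App. A of *Oracle separation of BQP and PH*) diagonalized against
`BPP^A` machines (`exists_oracle_BQPRel_not_subset_BPPRel_of`), fed with the discharged facts
`razTal2022_bqpMachine_holds`, `razTal2022_claim81_holds`, `fSS84_phWindowCircuits_holds`,
`countable_polyTimeOracleAlg_holds` and Theorem 7.4 from Tal's tail bound
(`razTal2022_thm74_of_tal Tal2017_fourierL1_ac0_holds`) — same statement, different witness.
[cite: BernsteinVazirani1997, §8.4 Thm. 8.10 and Cor. 8.14] [cite: RazTalJACM2022, Cor. 1.5 (App. A)] -/
theorem exists_oracle_BQPRel_not_subset_BPPRel_holds : exists_oracle_BQPRel_not_subset_BPPRel :=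
  exists_oracle_BQPRel_not_subset_BPPRel_of razTal2022_bqpMachine_holds razTal2022_claim81_holds
    fSS84_phWindowCircuits_holds countable_polyTimeOracleAlg_holds
    (razTal2022_thm74_of_tal Tal2017_fourierL1_ac0_holds)

end Literature.Computability.QuantumComplexity
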